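import Mathlib
import Summits.ValiantsHypothesis.ValiantsHypothesis.Theorems.KPlusLogSqLawMonotonePencilInertia

/-!
# Route «KPlusLogSqLaw», `WeakLifting` (stmt-ValiantsHypothesis-19561) — the inertia law `Z ≤ ⌊m/2⌋` of the constant-link sector is SHARP for every `m`

HONEST FRAMING.  Companion (seat val-sym-lift-p2 g10, cell `pub-symmetroid`, 2026-08-28) to `…KPlusLogSqLawMonotonePencilInertia`
(`MonotoneInertia.card_posRoots_constLinks_le_half`: a static definite tridiagonal design in R2114 currency with CONSTANT LINKS — link exponents
`0` — and diagonal exponents `≥ 1` has at most `⌊m/2⌋` distinct positive determinant zeros).  Here: for EVERY `m` the bound is ATTAINED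
(`exists_constLinks_card_eq_half`), by the PAIRING DESIGN — diagonal entries `X`, link `k + 1` between the vertices `2k` and `2k + 1`
(`k < ⌊m/2⌋`), all other links `0`: its determinant is `X^{m mod 2} · ∏_{k<⌊m/2⌋} (X² − (k+1)²)`, and we check directly that each `x = k + 1` is a
zero (the vector `e_{2k} − e_{2k+1}` is in the kernel) and that the determinant is not the zero polynomial (strict diagonal dominance at
`x = m + 2`, Gershgorin).  So the constant-link (one-signed vertex-gauge) sector of the α register has the EXACT row `B(m) = ⌊m/2⌋`.  One-signed
sector = calibration; nothing here is about `WeakLifting` / `stub_tridiagonalSectorB` in their window, `TropicalB`, Conjecture B, the Door-A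
registers, `MatrixDescartes` (stmt-ValiantsHypothesis-18050) or VP ≠ VNP.  No `def`.  [folklore]
-/

set_option linter.dupNamespace false
set_option autoImplicit false

namespace Summit.ValiantsHypothesis.ValiantsHypothesis.Theorems.KPlusLogSqLaw

open Matrix Finset Polynomial
open scoped BigOperators

namespace MonotoneInertia

/-- evaluation of a design determinant `det (c_ij X^{e_ij})` at a real point. [folklore] -/
theorem eval_det_design {m : ℕ} (c : Fin m → Fin m → ℝ) (e : Fin m → Fin m → ℕ) (t : ℝ) :
    (Matrix.det (Matrix.of fun i j : Fin m => Polynomial.C (c i j) * (X : ℝ[X]) ^ e i j)).eval t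
      = Matrix.det (Matrix.of fun i j : Fin m => c i j * t ^ e i j) := by
  have h := RingHom.map_det (Polynomial.evalRingHom t) (Matrix.of fun i j : Fin m => Polynomial.C (c i j) * (X : ℝ[X]) ^ e i j)
  rw [Polynomial.coe_evalRingHom] at h
  rw [h]
  congr 1
  ext i j
  simp only [RingHom.mapMatrix_apply, Matrix.map_apply, Matrix.of_apply, Polynomial.coe_evalRingHom, Polynomial.eval_mul,
    Polynomial.eval_C, Polynomial.eval_pow, Polynomial.eval_X]

/-- **THE PAIRING DESIGN: `Z = ⌊m/2⌋` EXACTLY in the constant-link sector, for every `m`.**  There is a static definite tridiagonal design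
`(c, e)` in R2114 currency (`c`, `e` symmetric, `c = 0` off the band, `0 < c i i`) with constant links (`e i j = 0` for `i ≠ j`) and diagonal
exponents `≥ 1` whose determinant has exactly `⌊m/2⌋` distinct positive zeros (diagonal `X`, link `k+1` on the pair `{2k, 2k+1}`; zeros
`1, …, ⌊m/2⌋`).  With `card_posRoots_constLinks_le_half` this is the exact row of the sector. [folklore] -/
theorem exists_constLinks_card_eq_half (m : ℕ) :
    ∃ (c : Fin m → Fin m → ℝ) (e : Fin m → Fin m → ℕ), (∀ i j, c i j = c j i) ∧
      (∀ i j : Fin m, (i : ℕ) + 1 < j ∨ (j : ℕ) + 1 < i → c i j = 0) ∧ (∀ i, 0 < c i i) ∧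
      (∀ i j : Fin m, i ≠ j → e i j = 0) ∧ (∀ i, 1 ≤ e i i) ∧
      ((Matrix.det (Matrix.of fun i j : Fin m => Polynomial.C (c i j) * (X : ℝ[X]) ^ e i j)).roots.toFinset.filter
        (fun t : ℝ => 0 < t)).card = m / 2 := by
  classical
  -- the pairing design
  let c : Fin m → Fin m → ℝ := fun i j => if i = j then 1 else if (i : ℕ) / 2 = (j : ℕ) / 2 then ((i : ℕ) / 2 : ℕ) + 1 else 0
  let e : Fin m → Fin m → ℕ := fun i j => if i = j then 1 else 0
  have hc : ∀ i j, c i j = c j i := by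
    intro i j
    simp only [c]
    by_cases hij : i = j
    · subst hij; rfl
    · rw [if_neg hij, if_neg (Ne.symm hij)]
      by_cases h2 : (i : ℕ) / 2 = (j : ℕ) / 2
      · rw [if_pos h2, if_pos h2.symm, h2]
      · rw [if_neg h2, if_neg (Ne.symm h2)]
  have hband : ∀ i j : Fin m, (i : ℕ) + 1 < j ∨ (j : ℕ) + 1 < i → c i j = 0 := by
    intro i j hij
    have hne : i ≠ j := by rintro rfl; omega
    have h2 : (i : ℕ) / 2 ≠ (j : ℕ) / 2 := by omega
    simp only [c, if_neg hne, if_neg h2]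
  have hdiag : ∀ i, 0 < c i i := fun i => by simp [c]
  have hlink : ∀ i j : Fin m, i ≠ j → e i j = 0 := fun i j hij => by simp [e, hij]
  have hdeg : ∀ i, 1 ≤ e i i := fun i => by simp [e]
  refine ⟨c, e, hc, hband, hdiag, hlink, hdeg, ?_⟩
  set P := Matrix.det (Matrix.of fun i j : Fin m => Polynomial.C (c i j) * (X : ℝ[X]) ^ e i j) with hP
  apply le_antisymm (card_posRoots_constLinks_le_half c e hc hband hdiag hlink hdeg)
  -- lower bound: `1, …, ⌊m/2⌋` are roots
  -- (a) `P ≠ 0`: strict diagonal dominance at `x₀ = m + 2`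
  have hP0 : P ≠ 0 := by
    intro h0
    have hev := eval_det_design c e ((m : ℝ) + 2)
    rw [← hP, h0, Polynomial.eval_zero] at hev
    refine (det_ne_zero_of_sum_row_lt_diag (A := Matrix.of fun i j : Fin m => c i j * ((m : ℝ) + 2) ^ e i j) fun k => ?_) hev.symm
    -- row `k`: off-diagonal absolute row sum ≤ k/2 + 1 ≤ m, diagonal entry m + 2
    have hkk : (Matrix.of fun i j : Fin m => c i j * ((m : ℝ) + 2) ^ e i j) k k = (m : ℝ) + 2 := by
      simp [c, e]
    have hdiagk : ‖(Matrix.of fun i j : Fin m => c i j * ((m : ℝ) + 2) ^ e i j) k k‖ = (m : ℝ) + 2 := by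
      rw [hkk, Real.norm_eq_abs, abs_of_pos (by positivity)]
    rw [hdiagk]
    have hbound : ∀ j ∈ univ.erase k, ‖(Matrix.of fun i j : Fin m => c i j * ((m : ℝ) + 2) ^ e i j) k j‖
        ≤ if (k : ℕ) / 2 = (j : ℕ) / 2 then ((k : ℕ) / 2 : ℕ) + (1 : ℝ) else 0 := by
      intro j hj
      have hkj : k ≠ j := (Finset.ne_of_mem_erase hj).symm
      by_cases h2 : (k : ℕ) / 2 = (j : ℕ) / 2
      · simp only [Matrix.of_apply, c, e, if_neg hkj, pow_zero, mul_one, if_pos h2]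
        rw [Real.norm_eq_abs, abs_of_nonneg (by positivity)]
      · simp only [Matrix.of_apply, c, e, if_neg hkj, pow_zero, mul_one, if_neg h2, norm_zero, le_refl]
    refine (Finset.sum_le_sum hbound).trans_lt ?_
    -- at most one `j ≠ k` shares `k/2`, so the sum is ≤ k/2 + 1 ≤ m < m + 2
    have hsum : (∑ j ∈ univ.erase k, (if (k : ℕ) / 2 = (j : ℕ) / 2 then ((k : ℕ) / 2 : ℕ) + (1 : ℝ) else 0))
        ≤ ((k : ℕ) / 2 : ℕ) + 1 := by
      rw [Finset.sum_ite, Finset.sum_const_zero, add_zero, Finset.sum_const, nsmul_eq_mul]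
      have hcard : ((univ.erase k).filter fun j : Fin m => (k : ℕ) / 2 = (j : ℕ) / 2).card ≤ 1 := by
        refine Finset.card_le_one.mpr fun a ha b hb => ?_
        have ha' := (Finset.mem_filter.mp ha); have hb' := (Finset.mem_filter.mp hb)
        have hak : a ≠ k := Finset.ne_of_mem_erase ha'.1
        have hbk : b ≠ k := Finset.ne_of_mem_erase hb'.1
        have h1 : (a : ℕ) ≠ k := fun h => hak (Fin.ext h)
        have h2 : (b : ℕ) ≠ k := fun h => hbk (Fin.ext h)
        exact Fin.ext (by omega)
      have hnn : (0 : ℝ) ≤ ((k : ℕ) / 2 : ℕ) + 1 := by positivity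
      calc (((univ.erase k).filter fun j : Fin m => (k : ℕ) / 2 = (j : ℕ) / 2).card : ℝ) * ((((k : ℕ) / 2 : ℕ) : ℝ) + 1)
          ≤ 1 * ((((k : ℕ) / 2 : ℕ) : ℝ) + 1) := by
            exact mul_le_mul_of_nonneg_right (by exact_mod_cast hcard) hnn
        _ = _ := one_mul _
    refine hsum.trans_lt ?_
    have hk : ((k : ℕ) / 2 : ℕ) ≤ m := by have := k.2; omega
    have : (((k : ℕ) / 2 : ℕ) : ℝ) ≤ m := by exact_mod_cast hk
    linarith
  -- (b) each `k + 1`, `k < m/2`, is a root: the vector `e_{2k} − e_{2k+1}` is in the kernel at `x = k + 1`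
  have hroot : ∀ k : ℕ, k < m / 2 → P.IsRoot ((k : ℝ) + 1) := by
    intro k hk
    have ha : 2 * k < m := by omega
    have hb : 2 * k + 1 < m := by omega
    let a : Fin m := ⟨2 * k, ha⟩
    let b : Fin m := ⟨2 * k + 1, hb⟩
    have hab : a ≠ b := by intro h; have := congr_arg (fun x : Fin m => (x : ℕ)) h; simp [a, b] at this
    rw [Polynomial.IsRoot.def, hP, eval_det_design]
    set M := Matrix.of fun i j : Fin m => c i j * ((k : ℝ) + 1) ^ e i j with hM
    -- columns `a` and `b` of `M` agree
    have hcol : ∀ i, M i a = M i b := by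
      intro i
      simp only [hM, Matrix.of_apply, c, e]
      have ha2 : ((a : Fin m) : ℕ) / 2 = k := by simp [a]
      have hb2 : ((b : Fin m) : ℕ) / 2 = k := by simp [b]; omega
      by_cases hia : i = a
      · subst hia
        rw [if_pos rfl, if_pos rfl, if_neg hab, if_neg hab, if_pos (ha2.trans hb2.symm), ha2]
        ring
      · by_cases hib : i = b
        · subst hib
          rw [if_pos rfl, if_pos rfl, if_neg (Ne.symm hab), if_neg (Ne.symm hab), if_pos (hb2.trans ha2.symm), hb2]
          ring
        · have hi2 : (i : ℕ) / 2 ≠ k := by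
            intro h
            have h1 : (i : ℕ) ≠ 2 * k := fun h' => hia (Fin.ext (by simp [a, h']))
            have h2 : (i : ℕ) ≠ 2 * k + 1 := fun h' => hib (Fin.ext (by simp [b, h']))
            omega
          rw [if_neg hia, if_neg hib, if_neg hia, if_neg hib, if_neg (by rw [ha2]; exact hi2), if_neg (by rw [hb2]; exact hi2)]
    -- hence `M (e_a − e_b) = 0`
    obtain ⟨v, hv, hMv⟩ : ∃ v ≠ (0 : Fin m → ℝ), M *ᵥ v = 0 := by
      refine ⟨Pi.single a 1 - Pi.single b 1, ?_, ?_⟩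
      · intro h
        have := congr_fun h a
        simp [Pi.sub_apply, hab] at this
      · rw [Matrix.mulVec_sub]
        ext i
        simp only [Pi.sub_apply, Matrix.mulVec_single_one, Pi.zero_apply, Matrix.col_apply]
        rw [hcol i, sub_self]
    exact (Matrix.exists_mulVec_eq_zero_iff.mp ⟨v, hv, hMv⟩)
  -- (c) count
  have hsub : (Finset.range (m / 2)).image (fun k : ℕ => (k : ℝ) + 1) ⊆ P.roots.toFinset.filter (fun t : ℝ => 0 < t) := by
    intro t ht
    obtain ⟨k, hk, rfl⟩ := Finset.mem_image.mp ht
    refine Finset.mem_filter.mpr ⟨?_, by positivity⟩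
    exact Multiset.mem_toFinset.mpr ((Polynomial.mem_roots hP0).mpr (hroot k (Finset.mem_range.mp hk)))
  have hinj : Function.Injective (fun k : ℕ => (k : ℝ) + 1) := fun x y h => by exact_mod_cast (add_right_cancel h)
  calc m / 2 = ((Finset.range (m / 2)).image (fun k : ℕ => (k : ℝ) + 1)).card := by
        rw [Finset.card_image_of_injective _ hinj, Finset.card_range]
    _ ≤ _ := Finset.card_le_card hsub

end MonotoneInertia

end Summit.ValiantsHypothesis.ValiantsHypothesis.Theorems.KPlusLogSqLaw
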